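import Summits.QuantumFields.BalabanUV.T4Continuum.Spine.NE4.AutonomousSchemeCurrency
import Summits.QuantumFields.BalabanUV.T4Continuum.Spine.NE4.AutonomousSchemeAnalytic
import Literature.Analysis.Complex.EarleHamiltonBallFixedPoint

/-!
# Spine/NE4/AutonomousSchemeMargin — (R53) THE MARGIN RUNG OF THE AUTONOMOUS ROAD: a STRICT INWARD MAPPING of ONE ball of complexified
# states (analyticity + a uniform bound WITH A MARGIN — no linear object) gives (R42)'s orbit stability by the EARLE–HAMILTON theorem,
# hence NE4, node U2's companions and (AF-0r); the spectral datum (L) of (R43)∕(R45) and the linearisation shape of (R46) are REDUNDANT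
# in that regime; the margin itself is NECESSARY (a holomorphic self-map of the disc WITHOUT margin and NO rate)

Cell `pub-balaban-gaps` (YM blitz G2), seat `ne4`, generation 15 (unit `pub-balaban-gaps-ne4-g15`); record `HOME/ne/NE4.md` §5 (R53).

HONEST FRAMING.  NE4 = `T4CouplingMatching.ScaleShiftRate c θ γ β` (the η-rate of Bałaban's full β-functions) is NOT IN PRINT ([Balaban1987RG1] =
CMP **109** (1987) p. 264 «We will investigate other properties in a separate paper»; cell GAPS G-t4-U2-1∕-2) and is NOT proved here.  As in every
`AutonomousScheme*` file, each `def … : Prop` below is a HYPOTHESIS SHAPE about an ABSTRACT one-step map `A : ℝ → E → E` (coupling, state ↦ state) on an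
abstract complex normed space `E` with bare state `0`; the theorems are compositions BY NAME of (i) the tree's Earle–Hamilton theorem for balls
(`Literature.Analysis.Complex.EarleHamilton.norm_sub_le_of_holoChain`, `….existsUnique_fixedPoint` [cite: EarleHamilton1970, Theorem] [cite: Chae1985, Thm 13.18]
[cite: Harris2003, Thm 3.1]) with (ii) the autonomous road's kernel (`Markov.ne4_of_stable`, `Markov.injectedRate_of_stable_relAnalytic`, census (R42)∕(R47))
and (iii) one explicit Möbius witness.  NOTHING of Bałaban's is instantiated or asserted; which space `E` and which map `A` realise the renormalization
operation RT of [Balaban1988Convergent] p. 262 is NOT decided here; no status word of the cell moves (NE4 stays DEPENDENT; NOT IN PRINT; NOT PROVED;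
spine 0∕9).  One finite T⁴; NOT ℝ⁴, NOT infinite volume, NOT a mass gap, NOT Clay.

THE POINT (fifteenth reader).  After (R43)–(R49) the autonomous road's CLOSED input list (`Markov.AutonomousRoad`, file `AutonomousSchemeClosed`) reads:
(L) a contracting power `‖T₀^N‖ ≤ θ′^N` of ONE complex-linear reference operator `T₀` [the Gaussian linearisation; or `ρ(T₀) < 1`, (R45)] · (An) STATE
ANALYTICITY of the step on a ball of ONE norm with a sup bound `M₀` (R46) · (Lin) the linearisation at the bare state `a·g`-close to `T₀` · (Src) a one-step
source `s` · a balance inequality · coupling-Lipschitz · read-out · representation.  Two items, (L) and (Lin), are statements about a LINEAR OBJECT `T₀`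
which print never isolates for Bałaban's RT (the «leading irrelevant eigenvalue» is lore, census (R32)); (An) is in Bałaban's own currency — analyticity +
uniform bounds ([Balaban1987RG1] p. 264 «analytic … uniformly bounded», the inductive hypotheses (0.33)).  THIS FILE: (L) and (Lin) are REDUNDANT as soon as
the analyticity statement carries a MARGIN.  If at every coupling `g ∈ ]0,γ]` the step `A g` is complex-differentiable on the ball `ball 0 ϱ` about the
bare state and maps it into the STRICTLY SMALLER concentric ball `closedBall 0 (qϱ)`, `q < 1` (§1 shape `StrictInward A ϱ q γ` — from (R46)'s own shapes:
`StateAnalytic A ϱ M₀ γ ∧ FirstStep A 0 s γ ∧ M₀ + s ≤ qϱ`, `strictInward_of_stateAnalytic`), then by EARLE–HAMILTON in the tree's ball form with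
Harris's chain estimate EVERY composite of admissible steps is Lipschitz on the inner ball with the geometrically decaying constant
`(2∕(1−q))·(2q∕(1+q))ⁿ` — no Lipschitz constant, no derivative and no linearisation of any single step enters —, i.e. (R42)'s natural-strength hypothesis
`OrbitStability A (closedBall 0 (qϱ)) (2∕(1−q)) (2q∕(1+q)) γ` HOLDS (§2 `orbitStability_of_strictInward`), the inner ball is invariant and the first-step
displacement is `D = qϱ` for free; so (§3) `ne4_of_stable` gives node U2's β-side triple `ScaleShiftRate ∧ HistLipschitz ∧ FadingMemory` at rate
`2q∕(1+q)` (`ne4_of_strictInward`), `conv_of_scaleShiftRate` the β⁰-half (AF-0r) (`conv_of_strictInward`), and (R47)'s `injectedRate_of_stable_relAnalytic`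
node U2's output `InjectedRate` (`injectedRate_of_strictInward_relAnalytic`) — from an input list consisting of ANALYTICITY-DOMAIN STATEMENTS WITH
UNIFORM BOUNDS ONLY: {STATE: strict inward mapping of one ball of complexified states; COUPLING: relative analytic charts `|ζ − g| < ρc·g` with an
oscillation bound (R47); a read-out constant; the representation} — plus, at each frozen coupling, the FIXED POINT of the step in the ball exists and
is unique (`existsUnique_fixedPoint_of_strictInward`, `E` complete): the «renormalized trajectory» `g ↦ x⋆(g)` as a theorem-shaped object under ONE
hypothesis.  §4 THE MARGIN IS THE WHOLE CONTENT: for the disc involution `invol c z = (c − z)∕(1 − cz)` (`0 < c < 1`; a holomorphic self-map of the unit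
disc exchanging `0` and `c` — margin `q = 1` exactly, every other shape of the road in its strongest form: coupling-independent, read-out `re` 1-Lipschitz,
first step `c`) the represented β-family alternates `c, 0, c, 0, …`, so NE4 FAILS at every rate `θ < 1` (`not_scaleShiftRate_invol`) and no orbit
stability holds on the (invariant) disc (`not_orbitStability_invol`).  §5 records that the Earle–Hamilton rate `2q∕(1+q)` is NOT the sharp one (the linear
θ-map `q•z` has rate `q < 2q∕(1+q)`; the sharp rate on this road is `ρ(T₀)⁺`, (R45) `spectralRadius_le_of_orbitStability_linear`) — the margin rung buys
the removal of the linear datum with a worse rate constant, never a rate below the spectral one.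

WHAT THIS SAYS FOR THE ROW (census (R53); classification words UNCHANGED).  On the autonomous road the «missing idea» of `HOME/ne/NE4.md` §6 now has a
formulation with NO linear∕spectral datum and NO modulus at all: «for every marginal coupling `g ∈ ]0,γ]`, Bałaban's k-independent operation RT_g,
acting on ONE complex Banach space of (complexified, infinite-volume, unit-lattice) irrelevant activities, is holomorphic on a ball about the pure
Wilson state and maps it into a strictly smaller concentric ball» — analyticity + a uniform bound, the TYPE of the printed inductive step
([Balaban1988Convergent] Thm 1 p. 262: the densities `ρ_k = (RT)^k ρ₀` satisfy the inductive hypotheses with the SAME constants — a self-map of the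
«ball» of admissible activities, margin `q = 1`), EXCEPT for two things print does not give: the MARGIN `q < 1` in one fixed norm (= «the irrelevant
directions contract», the renormalized-trajectory lore (R32) in its weakest analytic dress) and the COMPLEXIFICATION of the activities as a state
variable (print complexifies fields and couplings, (R34)∕(R40)∕(R46), never the activities).  §4 shows the first is not decoration.  Regime caveat
(honest): the margin is NOT invariant under equivalent norms — a step whose linearisation is non-normal (contracting power `N ≥ 2` only) has no margin in
the given norm, and there (R43)∕(R45)'s adapted-norm device (`Kc`, `gaugeBall`) with the linear datum remains the formulation; in the natural regime of the
lore (‖T₀‖ = L⁻² < 1 in the working norm, `N = 1`) the margin follows from (An)+(Lin)+(L) on a small ball (by (R46)'s `taylor_two_of_stateAnalytic`: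
`‖A g z‖ ≤ s + (‖T₀‖ + aγ)ϱ + 2M₀ϱ²∕ϱ₀²` on `ball 0 ϱ` — elementary, not typed here) and conversely forces ‖fderiv (A g) 0‖ ≤ 2q (`norm_fderiv_le_of_strictInward`)
— the two lists describe the same maps, the margin list without naming `T₀`.  NOT PRINTED for Bałaban's RT in any
form; nothing of Bałaban's asserted; NE4 NOT proved.
-/

noncomputable section

namespace Summit.QuantumFields.BalabanUV.T4Continuum.Spine.NE4

open Literature.MathematicalPhysics.QuantumFieldTheory.Balaban1983to89
open Literature.MathematicalPhysics.QuantumFieldTheory.Balaban1983to89.FlowStep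
open Literature.MathematicalPhysics.QuantumFieldTheory.Balaban1983to89.T4CouplingMatching
  (ScaleShiftRate HistLipschitz FadingMemory disc)
open Literature.MathematicalPhysics.QuantumFieldTheory.Balaban1983to89.T4FlagMemory
  (extd extd_coe extd_adm extd_tail tail_mem_box Adm)
open Literature.Analysis.Complex.EarleHamilton (norm_sub_le_of_holoChain existsUnique_fixedPoint)
open Metric Set

namespace Markov

/-! ## §1 The shape: strict inward mapping of ONE ball of complexified states; bridges from (R46)'s shapes; what it gives back -/

section Shapes

variable {E : Type*} [NormedAddCommGroup E] [NormedSpace ℂ E] {A : ℝ → E → E} {ϱ q γ : ℝ}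

/-- [shape] HYPOTHESIS SHAPE (NOT PRINTED for Bałaban's RT in any form; printed TYPE without the margin: [Balaban1988Convergent] Thm 1 p. 262, the
densities `(RT)^k ρ₀` satisfy the inductive hypotheses with the same constants): **STRICT INWARD MAPPING** — at every marginal coupling `g ∈ ]0,γ]`
the step `A g` is complex-differentiable on the open ball `ball 0 ϱ` of ONE norm about the bare state `0` and maps it into the strictly smaller
concentric closed ball `closedBall 0 (q·ϱ)` (`q < 1` is the MARGIN).  Analyticity + a uniform bound; NO linear object.  NOT a fact. [folklore] -/
def StrictInward (A : ℝ → E → E) (ϱ q γ : ℝ) : Prop :=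
  ∀ g : ℝ, 0 < g → g ≤ γ → DifferentiableOn ℂ (A g) (ball (0 : E) ϱ) ∧ MapsTo (A g) (ball (0 : E) ϱ) (closedBall (0 : E) (q * ϱ))

/-- **BRIDGE FROM (R46)'s SHAPES**: state analyticity with a sup bound `M₀` on `ball 0 ϱ` (`StateAnalytic A ϱ M₀ γ`) plus a one-step source bound
`‖A g 0‖ ≤ s` (`FirstStep A 0 s γ`) with `M₀ + s ≤ q·ϱ` IS a strict inward mapping with margin `q` — (R46)'s (An)+(Src) alone, WITHOUT its (L)∕(Lin). [folklore] -/
theorem strictInward_of_stateAnalytic {M₀ s : ℝ} (h : StateAnalytic A ϱ M₀ γ) (hsrc : FirstStep A 0 s γ) (hle : M₀ + s ≤ q * ϱ) :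
    StrictInward A ϱ q γ := by
  intro g hg0 hgγ
  obtain ⟨hd, hosc⟩ := h g hg0 hgγ
  refine ⟨hd, fun z hz => ?_⟩
  rw [mem_closedBall_zero_iff]
  have h0 : ‖A g 0‖ ≤ s := by simpa [dist_eq_norm] using hsrc g hg0 hgγ
  calc ‖A g z‖ = ‖(A g z - A g 0) + A g 0‖ := by rw [sub_add_cancel]
    _ ≤ ‖A g z - A g 0‖ + ‖A g 0‖ := norm_add_le _ _
    _ ≤ M₀ + s := add_le_add (hosc z hz) h0
    _ ≤ q * ϱ := hle

/-- [bookkeeping] Under a strict inward mapping with `0 ≤ q < 1`, `0 < ϱ`, the inner ball `closedBall 0 (qϱ)` is INVARIANT — (R43)'s item (S) is OUTPUT. [folklore] -/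
theorem invariant_of_strictInward (hq1 : q < 1) (hϱ : 0 < ϱ) (h : StrictInward A ϱ q γ) :
    Invariant A (closedBall (0 : E) (q * ϱ)) γ := by
  intro g hg0 hgγ x hx
  have hsub : closedBall (0 : E) (q * ϱ) ⊆ ball (0 : E) ϱ := closedBall_subset_ball (by nlinarith)
  exact (h g hg0 hgγ).2 (hsub hx)

/-- [bookkeeping] Under a strict inward mapping the FIRST STEP moves the bare state by at most `q·ϱ` — (R42)'s `FirstStep` is OUTPUT, `D = qϱ`. [folklore] -/
theorem firstStep_of_strictInward (hϱ : 0 < ϱ) (h : StrictInward A ϱ q γ) : FirstStep A 0 (q * ϱ) γ := by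
  intro g hg0 hgγ
  have h0 : (0 : E) ∈ ball (0 : E) ϱ := mem_ball_self hϱ
  simpa [dist_eq_norm] using (h g hg0 hgγ).2 h0

/-- **THE LINEAR DATUM IS OUTPUT** (Schwarz, Mathlib `Complex.norm_fderiv_le_div_of_mapsTo_ball`): under a strict inward mapping `‖fderiv ℂ (A g) 0‖ ≤ 2q`
for `g ∈ ]0,γ]` (the image ball `closedBall 0 (qϱ)` lies in `closedBall (A g 0) (2qϱ)`); so (R45)'s spectral datum `ρ(fderiv (A g) 0) ≤ 2q` is a
CONSEQUENCE of the margin, not an extra input (for `q < 1∕2` already a one-step norm contraction of the linearisation). [folklore] -/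
theorem norm_fderiv_le_of_strictInward (hϱ : 0 < ϱ) (h : StrictInward A ϱ q γ) {g : ℝ} (hg0 : 0 < g) (hgγ : g ≤ γ) :
    ‖fderiv ℂ (A g) 0‖ ≤ 2 * q := by
  obtain ⟨hd, hm⟩ := h g hg0 hgγ
  have hmaps : MapsTo (A g) (ball (0 : E) ϱ) (closedBall (A g 0) (2 * q * ϱ)) := by
    intro z hz
    have hz' := mem_closedBall_zero_iff.1 (hm hz)
    have h0' := mem_closedBall_zero_iff.1 (hm (mem_ball_self hϱ))
    rw [mem_closedBall, dist_eq_norm]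
    calc ‖A g z - A g 0‖ ≤ ‖A g z‖ + ‖A g 0‖ := norm_sub_le _ _
      _ ≤ q * ϱ + q * ϱ := add_le_add hz' h0'
      _ = 2 * q * ϱ := by ring
  have := Complex.norm_fderiv_le_div_of_mapsTo_ball hd hmaps hϱ
  calc ‖fderiv ℂ (A g) 0‖ ≤ 2 * q * ϱ / ϱ := this
    _ = 2 * q := by field_simp

end Shapes

/-! ## §2 Earle–Hamilton: orbit stability and the frozen-coupling fixed point from the margin alone -/

section EarleHamilton

variable {E : Type*} [NormedAddCommGroup E] [NormedSpace ℂ E] {A : ℝ → E → E} {ϱ q γ : ℝ}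

/-- **ORBIT STABILITY FROM THE MARGIN (Earle–Hamilton ∕ Harris chain estimate, the tree's `EarleHamilton.norm_sub_le_of_holoChain`).**  A strict inward
mapping with margin `0 < q < 1` on `ball 0 ϱ` (`ϱ > 0`) gives (R42)'s natural-strength hypothesis on the inner ball:
`OrbitStability A (closedBall 0 (qϱ)) (2∕(1−q)) (2q∕(1+q)) γ` — every composite `iter A g i n` of admissible steps is `(2∕(1−q))·(2q∕(1+q))ⁿ`-Lipschitz
there.  No Lipschitz constant, derivative bound or linearisation of a single step is used: the steps `A (g (i+m))` form a «holo-chain» of θ-self-maps of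
one ball. [cite: EarleHamilton1970, Theorem] [cite: Chae1985, Thm 13.18] [cite: Harris2003, Thm 3.1] -/
theorem orbitStability_of_strictInward (hϱ : 0 < ϱ) (hq0 : 0 < q) (hq1 : q < 1) (h : StrictInward A ϱ q γ) :
    OrbitStability A (closedBall (0 : E) (q * ϱ)) (2 / (1 - q)) (2 * q / (1 + q)) γ := by
  intro g hg i n x hx y hy
  rw [dist_eq_norm, dist_eq_norm]
  exact norm_sub_le_of_holoChain hϱ hq0 hq1 (f := fun m => A (g (i + m))) (T := fun m => iter A g i m)
    (fun m => (h (g (i + m)) (hg (i + m)).1 (hg (i + m)).2).1)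
    (fun m => (h (g (i + m)) (hg (i + m)).1 (hg (i + m)).2).2)
    (funext fun z => rfl) (fun m => funext fun z => rfl) n hx hy

/-- **THE FROZEN-COUPLING FIXED POINT** (the Earle–Hamilton fixed-point theorem itself, the tree's `EarleHamilton.existsUnique_fixedPoint`; `E` complete):
under a strict inward mapping, at every coupling `g ∈ ]0,γ]` the step `A g` has EXACTLY ONE fixed point in `ball 0 ϱ` (it lies in the inner ball) — the
«renormalized trajectory» point `x⋆(g)` as a theorem-shaped object under the ONE hypothesis of §1.  HYPOTHESIS about an abstract scheme; nothing of
Bałaban's asserted. [cite: EarleHamilton1970, Theorem] [cite: Chae1985, Thm 13.18] -/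
theorem existsUnique_fixedPoint_of_strictInward [CompleteSpace E] (hϱ : 0 < ϱ) (hq0 : 0 < q) (hq1 : q < 1)
    (h : StrictInward A ϱ q γ) {g : ℝ} (hg0 : 0 < g) (hgγ : g ≤ γ) :
    ∃! x, x ∈ ball (0 : E) ϱ ∧ A g x = x :=
  existsUnique_fixedPoint hϱ hq0 hq1 (h g hg0 hgγ).1 (h g hg0 hgγ).2

end EarleHamilton

/-! ## §3 NE4, node U2's companions, (AF-0r) and node U2's output from analyticity-domain statements only -/

section NE4

variable {E : Type*} [NormedAddCommGroup E] [NormedSpace ℂ E] {A : ℝ → E → E} {r : E → ℝ} {β : HBeta} {ϱ q γ ℓ cr : ℝ}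

/-- **NE4 FROM THE MARGIN.**  A strict inward mapping (`0 < q < 1`, `ϱ > 0`), a coupling-Lipschitz constant `ℓ` and a read-out constant `cr` on the inner
ball, and the representation of `β` by the scheme from the bare state `0` give node U2's β-side triple at the Earle–Hamilton rate `θ_EH = 2q∕(1+q)`:
`ScaleShiftRate (cr·(2∕(1−q))·(qϱ)·θ_EH) θ_EH γ β ∧ HistLipschitz Λ γ β ∧ FadingMemory (cr·(2∕(1−q))·ℓ) θ_EH Λ`, `Λ k i = cr·(2∕(1−q))·ℓ·θ_EH^{k−i}` —
`ne4_of_stable` (R42) with §2 and §1's free outputs (invariant inner ball, `D = qϱ`).  NO linear operator, NO spectral datum, NO linearisation shape,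
NO defect, NO balance inequality.  HYPOTHESES ONLY about an abstract scheme; NE4 for Bałaban's β is NOT proved. [folklore] -/
theorem ne4_of_strictInward (hϱ : 0 < ϱ) (hq0 : 0 < q) (hq1 : q < 1) (hcr : 0 ≤ cr) (hℓ : 0 ≤ ℓ) (h : StrictInward A ϱ q γ)
    (hlip : StateCouplingLipschitz A (closedBall (0 : E) (q * ϱ)) ℓ γ) (hrep : RepresentsAut A r 0 γ β)
    (hr : ReadLipschitzOn r (closedBall (0 : E) (q * ϱ)) cr) :
    ScaleShiftRate (cr * (2 / (1 - q)) * (q * ϱ) * (2 * q / (1 + q))) (2 * q / (1 + q)) γ β ∧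
    HistLipschitz (fun k i => cr * (2 / (1 - q)) * ℓ * (2 * q / (1 + q)) ^ (k - i)) γ β ∧
    FadingMemory (cr * (2 / (1 - q)) * ℓ) (2 * q / (1 + q)) (fun k i => cr * (2 / (1 - q)) * ℓ * (2 * q / (1 + q)) ^ (k - i)) :=
  ne4_of_stable (invariant_of_strictInward hq1 hϱ h) (mem_closedBall_self (by nlinarith)) (orbitStability_of_strictInward hϱ hq0 hq1 h)
    hlip (firstStep_of_strictInward hϱ h) (div_nonneg (by norm_num) (by linarith)) (div_nonneg (by linarith) (by linarith)) hcr hℓ hrep hr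

/-- **NE4 PROPER FROM THE MARGIN** (first component of `ne4_of_strictInward`). [folklore] -/
theorem scaleShiftRate_of_strictInward (hϱ : 0 < ϱ) (hq0 : 0 < q) (hq1 : q < 1) (hcr : 0 ≤ cr) (h : StrictInward A ϱ q γ)
    (hrep : RepresentsAut A r 0 γ β) (hr : ReadLipschitzOn r (closedBall (0 : E) (q * ϱ)) cr) :
    ScaleShiftRate (cr * (2 / (1 - q)) * (q * ϱ) * (2 * q / (1 + q))) (2 * q / (1 + q)) γ β :=
  scaleShiftRate_of_stable (invariant_of_strictInward hq1 hϱ h) (mem_closedBall_self (by nlinarith))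
    (orbitStability_of_strictInward hϱ hq0 hq1 h) (firstStep_of_strictInward hϱ h) (div_nonneg (by norm_num) (by linarith))
    (div_nonneg (by linarith) (by linarith)) hcr hrep hr

/-- **THE β⁰-HALF (AF-0r) FROM THE MARGIN** (`conv_of_scaleShiftRate`, census (R31)): with the printed one-loop split `Sp` and the (AF-1) corner bound
`|β¹_{k+1}(p)| ≤ C·p_last`, `∃ β⁰_∞, |β⁰_{k+1} − β⁰_∞| ≤ (c∕(1 − θ_EH))·θ_EH^k` with `c` the NE4 constant above.  Identification of `β⁰_∞` untouched. [folklore] -/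
theorem conv_of_strictInward (Sp : B12Beta.OneLoopSplit β) {C : ℝ} (hγ : 0 < γ) (hϱ : 0 < ϱ) (hq0 : 0 < q) (hq1 : q < 1) (hcr : 0 ≤ cr)
    (h : StrictInward A ϱ q γ) (hrep : RepresentsAut A r 0 γ β) (hr : ReadLipschitzOn r (closedBall (0 : E) (q * ϱ)) cr)
    (hC : ∀ k (p : Fin (k + 1) → ℝ), p ∈ Box γ k → |Sp.β1 k p| ≤ C * p (Fin.last k)) :
    ∃ binf : ℝ, ∀ k, |Sp.β0 k - binf| ≤
      cr * (2 / (1 - q)) * (q * ϱ) * (2 * q / (1 + q)) / (1 - 2 * q / (1 + q)) * (2 * q / (1 + q)) ^ k :=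
  conv_of_scaleShiftRate Sp hγ (Literature.Analysis.Complex.EarleHamilton.rate_lt_one hq1 (by linarith))
    hC (scaleShiftRate_of_strictInward hϱ hq0 hq1 hcr h hrep hr)

/-- **NODE U2's OUTPUT FROM ANALYTICITY-DOMAIN STATEMENTS ONLY** ((R47) `injectedRate_of_stable_relAnalytic` fed by §2): STATE — a strict inward mapping
(`0 < q < 1`, `ϱ > 0`); COUPLING — relative analytic charts `CouplingAnalyticRelState A (closedBall 0 (qϱ)) ρc M γ` (discs `|ζ − g| < ρc·g`, oscillation
`≤ M`); a read-out constant `cr`; the representation; IR-pinned runs of the printed recursion (0.20) in ]0,γ]; a target rate `ρ′ ∈ ]θ_EH, 1[` and the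
log-currency window `cr·(2∕(1−q))·(M∕ρc)·(γ²∕2)·ρ′∕(ρ′ − θ_EH) ≤ (1 − ρ′)∕2` ⟹ `InjectedRate (2·c∕(1 − ρ′)) 0 ρ′` (`c` = the NE4 constant).  NO spectral datum,
NO linearisation, NO modulus-type input, NO `EventualLowerH`.  Bookkeeping over UNPRINTED inputs. [folklore] -/
theorem injectedRate_of_strictInward_relAnalytic {ρc M ρ' : ℝ} (g : ℕ → ℕ → ℝ) (gIR : ℝ)
    (hγ : 0 < γ) (hϱ : 0 < ϱ) (hq0 : 0 < q) (hq1 : q < 1) (hρc : 0 < ρc) (hM : 0 ≤ M) (hρ'1 : ρ' < 1)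
    (hρ' : 2 * q / (1 + q) < ρ') (hcr : 0 ≤ cr)
    (h : StrictInward A ϱ q γ) (han : CouplingAnalyticRelState A (closedBall (0 : E) (q * ϱ)) ρc M γ)
    (hrep : RepresentsAut A r 0 γ β) (hr : ReadLipschitzOn r (closedBall (0 : E) (q * ϱ)) cr)
    (hrun : ∀ K, RGEqH K β (g K)) (hbox : ∀ K i, i ≤ K → 0 < g K i ∧ g K i ≤ γ) (hpin : ∀ K, g K K = gIR)
    (hsmall : cr * (2 / (1 - q)) * (M / ρc) * (γ ^ 2 / 2) * (ρ' / (ρ' - 2 * q / (1 + q))) ≤ (1 - ρ') / 2) :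
    T4CauchySum.InjectedRate (2 * (cr * (2 / (1 - q)) * (q * ϱ) * (2 * q / (1 + q))) / (1 - ρ')) 0 ρ'
      (fun K j => disc (g K) (g (K + 1)) j) :=
  injectedRate_of_stable_relAnalytic g gIR hγ hρc hM hρ'1 (div_pos (by linarith) (by linarith)) hρ'
    (div_nonneg (by norm_num) (by linarith)) hcr (by nlinarith)
    (invariant_of_strictInward hq1 hϱ h) (mem_closedBall_self (by nlinarith)) (orbitStability_of_strictInward hϱ hq0 hq1 h)
    han (firstStep_of_strictInward hϱ h) hrep hr hrun hbox hpin hsmall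

end NE4

/-! ## §4 The margin is necessary: a holomorphic self-map of the disc with NO margin, every other shape in force, and NO rate -/

section Witness

/-- The DISC INVOLUTION exchanging `0` and `c`: `invol c z = (c − z)∕(1 − c·z)` (for `0 < c < 1` a holomorphic automorphism of the unit disc,
`invol c ∘ invol c = id`). [folklore] -/
def invol (c : ℝ) (z : ℂ) : ℂ := ((c : ℂ) - z) / (1 - (c : ℂ) * z)

/-- [bookkeeping] `invol c 0 = c`. [folklore] -/
@[simp] theorem invol_zero (c : ℝ) : invol c 0 = c := by simp [invol]

/-- [bookkeeping] `invol c c = 0`. [folklore] -/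
@[simp] theorem invol_self (c : ℝ) : invol c c = 0 := by simp [invol]

/-- [bookkeeping] On the unit disc the denominator does not vanish (`|c| < 1`). [folklore] -/
theorem one_sub_mul_ne_zero {c : ℝ} (hc : |c| < 1) {z : ℂ} (hz : ‖z‖ < 1) : (1 : ℂ) - (c : ℂ) * z ≠ 0 := by
  intro h0
  have h1 : ‖(c : ℂ) * z‖ = 1 := by
    have : (c : ℂ) * z = 1 := by linear_combination -h0
    rw [this, norm_one]
  rw [norm_mul, Complex.norm_real, Real.norm_eq_abs] at h1
  have : |c| * ‖z‖ < 1 * 1 := mul_lt_mul'' hc hz (abs_nonneg _) (norm_nonneg _)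
  linarith

/-- **THE INVOLUTION MAPS THE DISC INTO THE DISC — margin exactly `q = 1`**: `‖invol c z‖ < 1` for `‖z‖ < 1`, `|c| < 1`
(`|c − z|² < |1 − cz|² ⟺ (1 − c²)(1 − |z|²) > 0`). [folklore] -/
theorem norm_invol_lt_one {c : ℝ} (hc : |c| < 1) {z : ℂ} (hz : ‖z‖ < 1) : ‖invol c z‖ < 1 := by
  have hden := one_sub_mul_ne_zero hc hz
  have hden' : 0 < ‖(1 : ℂ) - (c : ℂ) * z‖ := norm_pos_iff.2 hden
  rw [invol, norm_div, div_lt_one hden']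
  have key : ‖(c : ℂ) - z‖ ^ 2 < ‖(1 : ℂ) - (c : ℂ) * z‖ ^ 2 := by
    rw [Complex.sq_norm, Complex.sq_norm, Complex.normSq_apply, Complex.normSq_apply]
    simp only [Complex.sub_re, Complex.sub_im, Complex.ofReal_re, Complex.ofReal_im, Complex.mul_re, Complex.mul_im,
      Complex.one_re, Complex.one_im, zero_mul, sub_zero, zero_sub]
    have hz2 : z.re * z.re + z.im * z.im < 1 := by
      have := Complex.sq_norm z
      rw [Complex.normSq_apply] at this
      nlinarith [norm_nonneg z]
    have hc2 : c * c < 1 := by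
      have := abs_lt.1 hc
      nlinarith
    nlinarith [mul_pos (sub_pos.2 hc2) (sub_pos.2 hz2)]
  exact lt_of_pow_lt_pow_left₀ 2 hden'.le key

/-- The involution is complex-differentiable on the unit disc. [folklore] -/
theorem differentiableOn_invol {c : ℝ} (hc : |c| < 1) : DifferentiableOn ℂ (invol c) (ball (0 : ℂ) 1) := by
  intro z hz
  have hz' : ‖z‖ < 1 := mem_ball_zero_iff.1 hz
  refine DifferentiableAt.differentiableWithinAt ?_
  exact ((differentiableAt_const _).sub differentiableAt_id).div
    ((differentiableAt_const _).sub ((differentiableAt_const _).mul differentiableAt_id)) (one_sub_mul_ne_zero hc hz')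

/-- The COUPLING-INDEPENDENT SCHEME «apply the involution at every step». [folklore] -/
def involScheme (c : ℝ) : ℝ → ℂ → ℂ := fun _ z => invol c z

/-- **THE INVOLUTION SCHEME IS AN INWARD MAPPING WITH MARGIN EXACTLY ONE**: `StrictInward (involScheme c) 1 1 γ` (holomorphic on the unit disc, values
in the closed — indeed the open — unit disc), for `|c| < 1`. [folklore] -/
theorem strictInward_involScheme {c : ℝ} (hc : |c| < 1) (γ : ℝ) : StrictInward (involScheme c) 1 1 γ := by
  intro g _ _
  refine ⟨differentiableOn_invol hc, fun z hz => ?_⟩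
  rw [one_mul, mem_closedBall_zero_iff]
  exact (norm_invol_lt_one hc (mem_ball_zero_iff.1 hz)).le

/-- [bookkeeping] The involution scheme keeps the open unit disc (an invariant set containing the bare state). [folklore] -/
theorem invariant_involScheme {c : ℝ} (hc : |c| < 1) (γ : ℝ) : Invariant (involScheme c) (ball (0 : ℂ) 1) γ :=
  fun _ _ _ _ hz => mem_ball_zero_iff.2 (norm_invol_lt_one hc (mem_ball_zero_iff.1 hz))

/-- [bookkeeping] The scheme is coupling-independent: `StateCouplingLipschitz` with constant `0` on any set. [folklore] -/
theorem stateCouplingLipschitz_involScheme (c : ℝ) (S : Set ℂ) (γ : ℝ) : StateCouplingLipschitz (involScheme c) S 0 γ := by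
  intro g g' _ _ _ _ x _
  simp [involScheme]

/-- [bookkeeping] The first step moves the bare state by `|c|`. [folklore] -/
theorem firstStep_involScheme (c γ : ℝ) : FirstStep (involScheme c) 0 |c| γ := by
  intro g _ _
  simp [involScheme, dist_eq_norm]

/-- [bookkeeping] The read-out `re` is 1-Lipschitz on every set. [folklore] -/
theorem readLipschitzOn_re (S : Set ℂ) : ReadLipschitzOn Complex.re S 1 := by
  intro x _ x' _
  rw [one_mul, dist_eq_norm, ← Complex.sub_re]
  exact Complex.abs_re_le_norm _

/-- **THE ORBIT OF THE BARE STATE ALTERNATES**: along every coupling sequence the state after `j` steps is `0` for even `j` and `c` for odd `j`. [folklore] -/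
theorem state_involScheme (c : ℝ) (g : ℕ → ℝ) : ∀ j, state (involScheme c) 0 g j = if Even j then 0 else (c : ℂ)
  | 0 => by simp
  | j + 1 => by
    rw [state_succ, state_involScheme c g j]
    by_cases hj : Even j
    · simp [hj, Nat.even_add_one, involScheme]
    · simp [hj, Nat.even_add_one, involScheme]

/-- The β-family READ OFF the involution scheme by `re` (so the representation hypothesis holds by definition). [folklore] -/
def involBeta (c : ℝ) : HBeta := fun k v => (state (involScheme c) 0 (extd v) (k + 1)).re

/-- [bookkeeping] `RepresentsAut (involScheme c) re 0 γ (involBeta c)` — by definition. [folklore] -/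
theorem representsAut_involBeta (c γ : ℝ) : RepresentsAut (involScheme c) Complex.re 0 γ (involBeta c) := fun _ _ _ => rfl

/-- [bookkeeping] The represented family alternates: `involBeta c k v = c` for even `k`, `0` for odd `k` (history-independent). [folklore] -/
theorem involBeta_eq (c : ℝ) (k : ℕ) (v : Fin (k + 1) → ℝ) : involBeta c k v = if Even k then c else 0 := by
  rw [involBeta, state_involScheme]
  by_cases hk : Even k
  · simp [hk, Nat.even_add_one]
  · simp [hk, Nat.even_add_one]

/-- **THE SCALE SHIFT OF THE INVOLUTION FAMILY IS CONSTANT**: `|β (k+1) w − β k (tail w)| = |c|` for every `k` and every history. [folklore] -/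
theorem involBeta_shift (c : ℝ) (k : ℕ) (w : Fin (k + 2) → ℝ) : |involBeta c (k + 1) w - involBeta c k (Fin.tail w)| = |c| := by
  rw [involBeta_eq, involBeta_eq]
  by_cases hk : Even k
  · simp [hk, Nat.even_add_one]
  · simp [hk, Nat.even_add_one]

/-- **NO MARGIN, NO RATE: NE4 FAILS FOR THE INVOLUTION FAMILY AT EVERY RATE `θ < 1`** (`c ≠ 0`, `γ > 0`).  Every shape of the autonomous road holds for
`involScheme c` in its strongest form — holomorphic self-map of ONE ball (margin `q = 1` exactly, `strictInward_involScheme`), invariant ball containing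
the bare state, coupling-independent, 1-Lipschitz read-out, first step `|c|`, representation — yet `¬ ScaleShiftRate c′ θ γ (involBeta c)` for all
`c′` and all `θ < 1`: the margin `q < 1` of §1 cannot be weakened to `q = 1`. [folklore] -/
theorem not_scaleShiftRate_invol {c γ θ : ℝ} (hc : c ≠ 0) (hγ : 0 < γ) (hθ1 : θ < 1) (c' : ℝ) :
    ¬ ScaleShiftRate c' θ γ (involBeta c) := by
  intro hS
  have hcpos : 0 < |c| := abs_pos.2 hc
  -- the constant history `γ` lies in every box
  have hbox : ∀ k, (fun _ : Fin (k + 2) => γ) ∈ Box γ (k + 1) := fun k => mem_box.2 fun _ => ⟨hγ, le_rfl⟩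
  have hle : ∀ k, |c| ≤ c' * θ ^ k := fun k => by
    have h := hS k (fun _ => γ) (hbox k)
    rwa [involBeta_shift] at h
  have hc' : 0 < c' := by
    have h0 := hle 0
    rw [pow_zero, mul_one] at h0
    linarith
  obtain ⟨k, hk⟩ := exists_pow_lt_of_lt_one (div_pos hcpos hc') hθ1
  have h1 := hle k
  have h2 : c' * θ ^ k < c' * (|c| / c') := mul_lt_mul_of_pos_left hk hc'
  rw [mul_div_cancel₀ _ hc'.ne'] at h2
  linarith

/-- **NO ORBIT STABILITY WITHOUT MARGIN**: on the invariant unit disc the involution scheme admits NO orbit-stability constants `C ≥ 0`, `0 ≤ θ < 1`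
(`0 < |c| < 1`, `γ > 0`) — else `scaleShiftRate_of_stable` (R42) would give NE4, contradicting `not_scaleShiftRate_invol`. [folklore] -/
theorem not_orbitStability_invol {c γ θ C : ℝ} (hc0 : c ≠ 0) (hc1 : |c| < 1) (hγ : 0 < γ) (hC : 0 ≤ C) (hθ0 : 0 ≤ θ) (hθ1 : θ < 1) :
    ¬ OrbitStability (involScheme c) (ball (0 : ℂ) 1) C θ γ := fun hst =>
  not_scaleShiftRate_invol hc0 hγ hθ1 (1 * C * |c| * θ)
    (scaleShiftRate_of_stable (invariant_involScheme hc1 γ) (mem_ball_self one_pos) hst (firstStep_involScheme c γ) hC hθ0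
      zero_le_one (representsAut_involBeta c γ) (readLipschitzOn_re _))

end Witness

/-! ## §5 The Earle–Hamilton rate is not the sharp one -/

section Rate

/-- [bookkeeping] **THE PRICE OF THE MARGIN RUNG IS IN THE RATE, NOT IN THE INPUTS**: `q < 2q∕(1+q) < 1` for `0 < q < 1` — the Earle–Hamilton rate
exceeds the margin `q`, which is itself an upper bound for the sharp rate of a LINEAR θ-map (`q•z` maps `ball 0 ϱ` into `closedBall 0 (qϱ)` and has orbit
rate exactly `q`); on this road no rate below `ρ(T₀)` is available anyway ((R45) `spectralRadius_le_of_orbitStability_linear`). [folklore] -/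
theorem lt_ehRate_lt_one {q : ℝ} (hq0 : 0 < q) (hq1 : q < 1) : q < 2 * q / (1 + q) ∧ 2 * q / (1 + q) < 1 := by
  constructor
  · rw [lt_div_iff₀ (by linarith)]; nlinarith
  · exact Literature.Analysis.Complex.EarleHamilton.rate_lt_one hq1 (by linarith)

end Rate

end Markov

end Summit.QuantumFields.BalabanUV.T4Continuum.Spine.NE4

end
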